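import Literature.IUT.LogThetaLattice.PacketLogVolumes
import Literature.IUT.LogThetaLattice.PacketWeightsScaling

/-!
# [IUTchIII] Proposition 3.9 (ii) «Mono-analytic Compatibility» for the VERBATIM log-volume of GENERAL regions —
# `Prop39ii_monoAnalyticCompat` concluded BY NAME for `(const)·log μ_E` along coordinatewise measure-compatible
# poly-isomorphisms (proof-only companion of `PacketLogVolumes.lean` / `PacketWeights.lean`; abc-iut cell, layer L6)

S. Mochizuki, *Inter-universal Teichmüller theory III*, kurims manuscript (May 2020), §3, Proposition 3.9 (ii) p. 116
l. 28–50 [claim: Mochizuki2012, status: disputed]: «… one obtains [by a slight abuse of notation] log-volumes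
`μ^log_{α,v_ℚ} : 𝕄(𝓘^ℚ(^α𝒟^⊢_{v_ℚ})) → ℝ`; `μ^log_{A,v_ℚ} : 𝕄(𝓘^ℚ(^A𝒟^⊢_{v_ℚ})) → ℝ` … — where “𝕄(−)” is as in (i) above — which are
compatible with the log-volumes obtained in (i), relative to the natural poly-isomorphisms of Proposition 3.2, (i).»
Here `𝕄(−)` is the set of ALL nonempty compact open subsets (p. 115 l. 34) and the log-volume of a general region of a
tensor packet is the weighted one of Remark 3.1.1 (iii)/(iv): `(1/(N_E·D))·log μ_E(S)` with `μ_E` the `E`-weighted measure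
(`weightedMeasure`, `PacketWeights.lean`, abc-iut-L6-t4; the Cor. 3.12 crew's `Summit.ABC.IUTFork.Cor312Vol.packetLogvolE`).

abc-iut-L6-t4 typed the sentence as `Prop39ii_monoAnalyticCompat poly μD μF := ∀ e ∈ poly, ∀ S, μD S = μF (e '' S)`
(`PacketLogVolumes.lean`); abc-iut-L6-d3 concluded it BY NAME on direct-product regions / single containers with an
integral structure (`PacketLogVolumesProofs2/3.lean`). THIS FILE concludes it BY NAME for the general-region `E`-weighted
log-volumes of two packets `M_V^{(1)}` (mono-analytic side) and `M_V^{(2)}` (holomorphic side) with the SAME bookkeeping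
`(V, E)`, along any poly-isomorphism all of whose members are COORDINATEWISE measurable equivalences carrying `μ₁_v` to
`μ₂_v` — which is what the natural poly-isomorphisms of Prop. 3.2 (i) induce on log-shells once the discrepancy of
integral structures is adjusted (Rmk. 3.9.1; the adjustment itself is abc-iut-L6-d3's `monoAnalyticLogVolume_adjusted_eq`):

* `weightedMeasure_preimage_piCongrRight` — `μ_E^{(1)}(Φ⁻¹ S) = μ_E^{(2)}(S)` for EVERY `S ⊆ M_V^{(2)}` (no measurability
  needed: `Φ` is a measurable equivalence of the big products; Mathlib `MeasurableEquiv.map_apply` + `Measure.pi_map_pi`),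
  and `weightedMeasure_image_piCongrRight'` — `μ_E^{(2)}(Φ S) = μ_E^{(1)}(S)`;
* **`prop39ii_monoAnalyticCompat_weightedMeasure`** — **IUTchIII:Prop3.9(ii)** BY NAME:
  `Prop39ii_monoAnalyticCompat poly (c·log μ_E^{(1)}) (c·log μ_E^{(2)})` for every constant `c` (e.g. `1/(N_E·D)`) and every
  `poly` consisting of coordinatewise measure-compatible measurable equivalences.

No definitions; nothing here bears on the disputed [IUTchIII] Cor. 3.12 or takes a side; typed ≠ proved elsewhere.
-/

namespace Literature.IUT.LogThetaLattice

open MeasureTheory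
open scoped ENNReal

universe u₁ u₂ u₃

variable {V : Type u₁} [Fintype V] [DecidableEq V] {E : V → Type u₂} [∀ v, Fintype (E v)]
variable {M₁ M₂ : V → Type u₃} [∀ v, MeasurableSpace (M₁ v)] [∀ v, MeasurableSpace (M₂ v)]

/-- `μ_E` is transported by coordinatewise measure-compatible MEASURABLE EQUIVALENCES on EVERY region (no measurability
hypothesis): `μ_E^{(1)}(Φ⁻¹ S) = μ_E^{(2)}(S)` for `Φ = (φ_v)_v`, `(μ₁_v).map φ_v = μ₂_v` ([IUTchIII] Rmk. 3.1.1 (iv) p. 97: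
`μ_E` is determined by `(V, N, M)`). [claim: Mochizuki2012, status: disputed] (IUTchIII §3 Rmk 3.1.1 (iv), kurims p.97) -/
theorem weightedMeasure_preimage_piCongrRight (μ₁ : ∀ v, Measure (M₁ v)) (μ₂ : ∀ v, Measure (M₂ v))
    [∀ v, SigmaFinite (μ₂ v)] (φ : ∀ v, M₁ v ≃ᵐ M₂ v) (hφ : ∀ v, (μ₁ v).map (φ v) = μ₂ v) (S : Set (∀ v, M₂ v)) :
    weightedMeasure E M₁ μ₁ ((MeasurableEquiv.piCongrRight φ) ⁻¹' S) = weightedMeasure E M₂ μ₂ S := by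
  unfold weightedMeasure
  -- `S_E` of the preimage is the preimage of `S_E` under the coordinatewise equivalence of the big products
  have hset : weightedMeasureSet E M₁ ((MeasurableEquiv.piCongrRight φ) ⁻¹' S) =
      (MeasurableEquiv.piCongrRight fun w : WIndex E => φ w.1) ⁻¹' weightedMeasureSet E M₂ S :=
    Set.ext fun _ => Iff.rfl
  rw [hset, ← MeasurableEquiv.map_apply]
  haveI : ∀ w : WIndex E, SigmaFinite (((fun w : WIndex E => μ₁ w.1) w).map (φ w.1)) := fun w => by
    show SigmaFinite ((μ₁ w.1).map (φ w.1))
    rw [hφ]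
    infer_instance
  have hmap : (Measure.pi fun w : WIndex E => μ₁ w.1).map (MeasurableEquiv.piCongrRight fun w : WIndex E => φ w.1) =
      Measure.pi fun w : WIndex E => μ₂ w.1 := by
    have h := Measure.pi_map_pi (μ := fun w : WIndex E => μ₁ w.1) (f := fun w : WIndex E => ⇑(φ w.1))
      (fun w => (φ w.1).measurable.aemeasurable)
    have hfam : (fun w : WIndex E => (μ₁ w.1).map (φ w.1)) = fun w : WIndex E => μ₂ w.1 :=
      funext fun w => hφ w.1
    rw [hfam] at h
    exact h
  rw [hmap]

/-- Image form: `μ_E^{(2)}(Φ S) = μ_E^{(1)}(S)` for the coordinatewise measurable equivalence `Φ = (φ_v)_v` with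
`(μ₁_v).map φ_v = μ₂_v`, EVERY `S ⊆ M_V^{(1)}`. [claim: Mochizuki2012, status: disputed]
(IUTchIII §3 Rmk 3.1.1 (iv), kurims p.97) -/
theorem weightedMeasure_image_piCongrRight' (μ₁ : ∀ v, Measure (M₁ v)) (μ₂ : ∀ v, Measure (M₂ v))
    [∀ v, SigmaFinite (μ₂ v)] (φ : ∀ v, M₁ v ≃ᵐ M₂ v) (hφ : ∀ v, (μ₁ v).map (φ v) = μ₂ v) (S : Set (∀ v, M₁ v)) :
    weightedMeasure E M₂ μ₂ ((MeasurableEquiv.piCongrRight φ) '' S) = weightedMeasure E M₁ μ₁ S := by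
  rw [← weightedMeasure_preimage_piCongrRight μ₁ μ₂ φ hφ, (MeasurableEquiv.piCongrRight φ).preimage_image]

/-- **IUTchIII:Prop3.9(ii)** «(Mono-analytic Compatibility)» (kurims p.116 l.28–50) BY NAME, for the VERBATIM log-volumes
of GENERAL regions of two tensor packets with the same bookkeeping `(V, E)` — `μD := c·log μ_E^{(1)}` on the mono-analytic
side `M_V^{(1)}`, `μF := c·log μ_E^{(2)}` on the holomorphic side `M_V^{(2)}` (any constant `c`, e.g. `1/(N_E·D)`): for every
poly-isomorphism `poly` all of whose members are coordinatewise measurable equivalences carrying `μ₁_v` to `μ₂_v` (what the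
natural poly-isomorphisms of Prop. 3.2 (i) induce on log-shells after the adjustment of integral structures, Rmk. 3.9.1),
abc-iut-L6-t4's typed `Prop39ii_monoAnalyticCompat poly μD μF` HOLDS. [claim: Mochizuki2012, status: disputed]
(IUTchIII §3 Prop 3.9 (ii), kurims p.116) -/
theorem prop39ii_monoAnalyticCompat_weightedMeasure (μ₁ : ∀ v, Measure (M₁ v)) (μ₂ : ∀ v, Measure (M₂ v))
    [∀ v, SigmaFinite (μ₂ v)] (c : ℝ) (poly : Set ((∀ v, M₁ v) ≃ (∀ v, M₂ v)))
    (hpoly : ∀ e ∈ poly, ∃ φ : ∀ v, M₁ v ≃ᵐ M₂ v,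
      (∀ v, (μ₁ v).map (φ v) = μ₂ v) ∧ ⇑e = ⇑(MeasurableEquiv.piCongrRight φ)) :
    Prop39ii_monoAnalyticCompat poly (fun S => c * Real.log (weightedMeasure E M₁ μ₁ S).toReal)
      fun S => c * Real.log (weightedMeasure E M₂ μ₂ S).toReal := by
  intro e he S
  obtain ⟨φ, hφ, hcoe⟩ := hpoly e he
  show c * Real.log (weightedMeasure E M₁ μ₁ S).toReal = c * Real.log (weightedMeasure E M₂ μ₂ (e '' S)).toReal
  rw [Set.image_congr' (f := ⇑e) (g := ⇑(MeasurableEquiv.piCongrRight φ)) (fun x => by rw [hcoe]),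
    weightedMeasure_image_piCongrRight' μ₁ μ₂ φ hφ S]

end Literature.IUT.LogThetaLattice
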